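/-
Copyright (c) 2026 the pub-hodgecm-mathlib formalisation cell (harness21).  Prover seat hodgecm-mathlib-R90-C10-p01 (g2), SLAB R90-TF, section S1 «Ch. 10∕12 local», lent to
the cell «U4-RAM» (L4 line-lead K2E3-plan (g5), L4 DEALS ROUND 3 (5)); crux H413 = `stmt-HodgeConjecture-24833`; socket of record S1 A2′ = K2E3 leaf (U4f-χ₁-ram-one) ⊇ U4Keys
:155 (depth 0, Branch B) AT A TAME RAMIFIED PLACE — the RAMIFIED d0B chain of R90-C10-p05 (g0) (★ `R90S1BranchBAssemblyRamified`, 📤 `R90S1BranchBClosedFormsRamified`).  2026-09-04.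
KERNEL module: THEOREMS ONLY (no definition, no named fact, no `sorry`, no instance, no notation).
-/
import Summits.HodgeConjecture.HodgeConjecture.Theorems.K2E3BranchBSkewLineIntegrals      -- ★ p862177 (K2E3-p03 (g9)): `valued_add_apply_eq_max`, `conj_half_mul_conj_and_valued`, `valued_heisZ_apply_eq_max`, `setOf_isUnit_eq`; brings ★ `HeisenbergStrataMeasure` (master evaluation), ★ `unitModulusChar_eq_one_of_forall_v_eq_one`
import Summits.HodgeConjecture.HodgeConjecture.Theorems.K2E3BranchBShellRegions          -- ★ p862199 (K2E3-p32 (g0)): `measurableSet_setOf_v_eq_one`, `measurableSet_setOf_v_le_one` (the regions are Borel)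
import Literature.NumberTheory.Automorphic.LineStrataMeasureRamified                      -- ★ `valued_skew_apply_lt_one_of_ramified` (the integral skew line lies in `𝔪_w` at a ramified place)
import Literature.NumberTheory.Automorphic.HeisenbergStrataMeasureRamified                -- ★ `measure_setOf_valued_lt_one_of_ramified` (`μ(𝔪_w) = q⁻¹μ(𝒪_w)`), `setOf_skew_valued_lt_one_eq_of_ramified` (`𝔪⁻ = 𝒪⁻`)
import HarnessLib

/-!
# R90 · S1 ∕ U4Keys leaf (U4f-χ₁-ram-one-d0B) — THE EVEN SHELL `|z|_w = 1` AT A TAME RAMIFIED PLACE: `F₀ ≡ χ₁(−2)` there and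
# `∫_{|z|_w = 1} F₀ dμ = χ₁(−2) · ((q−1)∕q) · μ{|z|_w ≤ 1}` — letter `h0` of the ramified depth-zero Branch-B sockets   [Keys1984 §7 Thm (2) (d); Casselman1995 §6.4; Rogawski1990 §12.2]

Cell `hodgecm-mathlib`, SLAB R90-TF, section S1, crux H413 = `stmt-HodgeConjecture-24833` (lane `--supports … --as helper`), route of record `HCCMUnconditional` (no route verbs);
prover seat `hodgecm-mathlib-R90-C10-p01` (g2), lent to «U4-RAM» (dealer K2E3-plan (g5)).  THE PAYER of the letter `h0` of R90-C10-p05 (g0)'s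
`R90S1BranchBClosedFormsRamified.integral_weyl_one_eq_of_shells_ram` ∕ `…weyl_weyl…` (📤 p862406) and of the coming wrapper `exists_eta_of_reducible_of_shells_ram`, in their exact
letters: the frame-v1 integrand `F₀(n) = χ₁(σ n̂₀₂)⁻¹ · ‖n̂₀₂‖⁻¹` over `n : ↥(cmBorelTriple L 3 v).N`, the shell `Sh 0 = {|(n₀₂)_w| = 1}`, the volume `V = μ.real{|(n₀₂)_w| ≤ 1}`,
`q = N𝔭_v`; the constant is `c₀ := χ₁(−2)` (`c₀² = 1`).  THEOREMS ONLY; ★-only imports.  NOT THE PAYER of :155.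

THE MATHEMATICS (PAPER-Z3-DepthZeroRamified §1 (R90-C10-p05), screened by R90-C10-audit1 22:05:37Z).  `R := L ⊗ L⁺_v = L_w` (one place `w ∣ v`, `e(w|v) = 2`, `|2|_w = 1`),
`σ = c ⊗ 1`; `χ₁` with :155's letters `hdepth` (trivial on principal units) and `hB` (`χ₁(u·σu) = 1` on units).  For `n ∈ N` write `z = n₀₂`, `x = n₀₁`; unitarity gives
`z + σz = −xσx` (★ `HeisRing.umat_zero_two_add_map`), so `z = a + y` with `a := −½xσx` `σ`-FIXED (`|a|_w = |x|_w²`) and `y := z − a` `σ`-SKEW.  PARITY: `|a + y|_w =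
max(|a|_w, |y|_w)` (★ `valued_add_apply_eq_max`) and an integral skew element has `|y|_w < 1` at a ramified place (★ `valued_skew_apply_lt_one_of_ramified`: `σ ≡ id mod 𝔪_w`).
Hence on the shell `|z|_w = 1`: `|y|_w < 1`, `|a|_w = 1`, `|x|_w = 1`, and `χ₁(ẑ) = χ₁(â)·χ₁(1 + y∕a) = χ₁(−½)·χ₁(x̂·σx̂)·1 = χ₁(−½)` (`hB` on `x̂`, `hdepth` on `ẑ∕â`), `χ₁(σẑ) =
χ₁(ẑ)⁻¹` (`hB` on `ẑ`), `‖ẑ‖ = 1`; so **`F₀(n) = χ₁(σẑ)⁻¹‖ẑ‖⁻¹ = χ₁(−½) = χ₁(−2)`** (`χ₁(−2)·χ₁(−½) = 1`, `χ₁(−2)² = χ₁((−2)·σ(−2)) = 1`).  VOLUME: in the Heisenberg chart `N ≃ R × R⁻`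
(★ `HeisRing.heisHomeomorph`, `|z|_w = max(|x|_w², |y|_w)` ★ `valued_heisZ_apply_eq_max`) the ball `{|z|_w ≤ 1}` is `𝒪 × 𝒪⁻` and `{|z|_w < 1}` is `𝔪 × 𝔪⁻ = 𝔪 × 𝒪⁻` (ramified: `𝔪⁻ = 𝒪⁻`
★), so by the master evaluation ★ `exists_measure_eq_mul_of_preimage_heisHomeomorph` and `μ_R(𝔪) = q⁻¹μ_R(𝒪)` (★ ramified ball ratio) **`μ{|z|_w < 1} = q⁻¹·μ{|z|_w ≤ 1}`** and
**`μ(Sh 0) = (1 − q⁻¹)·μ{|z|_w ≤ 1}`** — `vol N(𝔭) ∕ vol N₀ = q⁻¹` of the paper (cf. ★ `R90S1BranchBHaarFactsNRamified` in the (G3)-frame currency).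
* §1 **`chi_neg_two_sq_eq_one_ram`** (`c₀² = 1`), **`casselmanIntegrand_eq_chi_neg_two_of_v_eq_one_ram`** (`F₀ ≡ χ₁(−2)` on `Sh 0`).
* §2 **`preimage_heisHomeomorph_setOf_v_le_one`** ∕ **`…_lt_one`** (the chart preimages `𝒪 × 𝒪⁻`, `𝔪 × 𝔪⁻` — place-generic), **`isCompact_setOf_v_le_one_of_v_two`**,
  **`measure_setOf_v_lt_one_eq_ram`**, **`measureReal_setOf_v_eq_one_eq_ram`** (the two volumes, frame-free, every Haar `μ`).
* §3 **`integral_Sh_zero_eq_ram`** — `∫_{Sh 0} F₀ dμ = c₀ * ((q − 1) ∕ q) * V`, `c₀ = χ₁(−2)`: EXACTLY the binder `h0` of 📤 p862406 (with its free `c₀` so instantiated).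
HONEST LABEL: HC_CM is proved only modulo the 7 printed citations (2 remaining named inputs: hLiu418 = `stmt-HodgeConjecture-24832`, h413 = `stmt-HodgeConjecture-24833`)
until rung 0 closes; count-neutral — this file does NOT pay :155 (the odd shell `h1` and the wrapper remain); no printed citation is discharged.

## References
* [Keys1984] D. Keys, *Principal series representations of special unitary groups over local fields*, Compositio Math. 51 (1984), §3–§4, §7 Thm (2) (d) p. 126.
* [Casselman1995] W. Casselman, *Introduction to the theory of admissible representations of `p`-adic reductive groups* (1995), §6.4 p. 63.
* [Rogawski1990] J. D. Rogawski, *Automorphic Representations of Unitary Groups in Three Variables*, Ann. of Math. Stud. 123 (1990), §1.10 p. 9; §4.9 p. 54; §12.2 p. 173.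
* [Serre1979] J.-P. Serre, *Local Fields*, GTM 67 (1979), Ch. I §7–§8, Ch. IV §1 (the inertia group acts trivially on the residue field).
-/

set_option autoImplicit false
-- the mandated namespace has the single-problem summit's repeated segment (`HodgeConjecture.HodgeConjecture`)
set_option linter.dupNamespace false

noncomputable section

open NumberField IsDedekindDomain MeasureTheory Measure
open scoped Matrix MatrixGroups WithZero Valued NNReal ENNReal
open Literature.NumberTheory Literature.NumberTheory.Automorphic Literature.NumberTheory.Automorphic.UnitaryGroup

namespace Summit.HodgeConjecture.HodgeConjecture.R90.S1

open Summit.HodgeConjecture.HodgeConjecture.Cruxes.H413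
open Summit.HodgeConjecture.HodgeConjecture.Cruxes.H413.K2E3BranchBSkewLineIntegrals

open Classical

variable (L : Type) [Field L] [NumberField L] [IsCMField L] (v : HeightOneSpectrum (𝓞 ↥(maximalRealSubfield L)))
  (w : PlacesOver L v) (hw : IsCMField.complexConj L • w.1 = w.1)

/-! ## §1 The integrand is the constant `χ₁(−2)` on the even shell `|z|_w = 1` -/

include hw in
/-- **`χ₁(−2)² = 1`** under Branch B at a place with `|2|_w = 1`: `−2` is a `σ`-fixed unit of valuation one, so `χ₁(−2)² = χ₁((−2)·σ(−2)) = 1` (`hB`).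
[cite: Keys1984, §7 Theorem (2) (d) p. 126] [cite: Rogawski1990, §12.2 p. 173] -/
theorem chi_neg_two_sq_eq_one_ram [Invertible (2 : LocalRing L v)] (h2w : Valued.v (2 : w.1.adicCompletion L) = 1)
    (χ₁ : (LocalRing L v)ˣ →* ℂˣ)
    (hB : ∀ u : (LocalRing L v)ˣ, (∀ w' : PlacesOver L v, Valued.v ((u : LocalRing L v) w') = 1) →
      χ₁ (u * Units.map (conjLocal L (IsCMField.complexConj L) v : LocalRing L v →* LocalRing L v) u) = 1) :
    ((χ₁ (-(unitOfInvertible (2 : LocalRing L v))) : ℂˣ) : ℂ) ^ 2 = 1 := by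
  haveI : Algebra.IsQuadraticExtension ↥(maximalRealSubfield L) L := IsCMField.isQuadraticExtension L
  haveI : Subsingleton (PlacesOver L v) :=
    PlacesOver.subsingleton_of_smul_eq (IsCMField.complexConj L) (IsCMField.complexConj_ne_one L) w hw
  have hval : ((-(unitOfInvertible (2 : LocalRing L v)) : (LocalRing L v)ˣ) : LocalRing L v) = -2 := by
    rw [Units.val_neg, val_unitOfInvertible]
  have hσ : Units.map (conjLocal L (IsCMField.complexConj L) v : LocalRing L v →* LocalRing L v) (-(unitOfInvertible (2 : LocalRing L v))) =
      -(unitOfInvertible (2 : LocalRing L v)) :=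
    Units.ext (by rw [Units.coe_map, MonoidHom.coe_coe, hval, map_neg, map_ofNat])
  have h1 : ∀ w' : PlacesOver L v, Valued.v (((-(unitOfInvertible (2 : LocalRing L v)) : (LocalRing L v)ˣ) : LocalRing L v) w') = 1 := by
    intro w'
    obtain rfl : w' = w := Subsingleton.elim _ _
    rw [hval, Pi.neg_apply, Valuation.map_neg, Pi.ofNat_apply, h2w]
  have h := hB _ h1
  rw [hσ, ← sq, map_pow] at h
  rw [← Units.val_pow_eq_pow_val, h, Units.val_one]

include hw in
set_option maxHeartbeats 1600000 in
set_option synthInstance.maxHeartbeats 400000 in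
-- one long algebraic bookkeeping proof over the product ring `Π_{w ∣ v} L_w` with the GL-coercion chain in the statement
/-- **`F₀ ≡ χ₁(−2)` ON THE EVEN SHELL.**  `v` non-split, `w ∣ v` RAMIFIED (`he`) with `|2|_w = 1`; `χ₁` with :155's `hdepth`, `hB`.  For `n ∈ N(L⁺_v)` with `|(n₀₂)_w|_w = 1`:
`F₀(n) := χ₁(σ n̂₀₂)⁻¹ · ‖n̂₀₂‖⁻¹ = χ₁(−2)`.  Proof: `z = n₀₂ = a + y`, `a = −½ n₀₁σ(n₀₁)` fixed, `y` skew (unitarity ★ `umat_zero_two_add_map`); `max(|a|_w, |y|_w) = 1` (★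
`valued_add_apply_eq_max`) and `|y|_w < 1` (★ `valued_skew_apply_lt_one_of_ramified`), so `|a|_w = |n₀₁|_w² = 1`; `χ₁(ẑ) = χ₁(−½)·χ₁(x̂σx̂)·χ₁(ẑ∕â) = χ₁(−½)` (`hB`, `hdepth`),
`χ₁(σẑ) = χ₁(ẑ)⁻¹` (`hB`), `‖ẑ‖ = 1` (★ `unitModulusChar_eq_one_of_forall_v_eq_one`). [cite: Keys1984, §7 Theorem (2) (d) p. 126] [cite: Rogawski1990, §1.10 p. 9; §12.2 p. 173]
[cite: Serre1979, Ch. I §8, Ch. IV §1] -/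
theorem casselmanIntegrand_eq_chi_neg_two_of_v_eq_one_ram [Invertible (2 : LocalRing L v)]
    (he : v.asIdeal.ramificationIdx' w.1.asIdeal ≠ 1) (h2w : Valued.v (2 : w.1.adicCompletion L) = 1)
    (χ₁ : (LocalRing L v)ˣ →* ℂˣ)
    (hdepth : ∀ u : (LocalRing L v)ˣ, (∀ w' : PlacesOver L v, Valued.v (((u : LocalRing L v) w') - 1) < 1) → χ₁ u = 1)
    (hB : ∀ u : (LocalRing L v)ˣ, (∀ w' : PlacesOver L v, Valued.v ((u : LocalRing L v) w') = 1) →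
      χ₁ (u * Units.map (conjLocal L (IsCMField.complexConj L) v : LocalRing L v →* LocalRing L v) u) = 1)
    (n : ↥(cmBorelTriple L 3 v).N) (hn : Valued.v (((((n : ↥(unitaryGroupOfForm (conjLocal L (IsCMField.complexConj L) v) (cmLocalForm L 3 v))) : GL (Fin 3) (LocalRing L v)) : Matrix (Fin 3) (Fin 3) (LocalRing L v)) 0 2) w) = 1) :
    (if h : IsUnit ((((n : ↥(unitaryGroupOfForm (conjLocal L (IsCMField.complexConj L) v) (cmLocalForm L 3 v))) : GL (Fin 3) (LocalRing L v)) : Matrix (Fin 3) (Fin 3) (LocalRing L v)) 0 2) then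
          ((((χ₁ (Units.map ((conjLocal L (IsCMField.complexConj L) v) : LocalRing L v →* LocalRing L v) h.unit))⁻¹ : ℂˣ) : ℂ) *
            ((((unitModulusChar (LocalRing L v) h.unit)⁻¹ : ℝ≥0) : ℝ) : ℂ))
        else 0) = ((χ₁ (-(unitOfInvertible (2 : LocalRing L v))) : ℂˣ) : ℂ) := by
  classical
  haveI : Algebra.IsQuadraticExtension ↥(maximalRealSubfield L) L := IsCMField.isQuadraticExtension L
  haveI : Subsingleton (PlacesOver L v) :=
    PlacesOver.subsingleton_of_smul_eq (IsCMField.complexConj L) (IsCMField.complexConj_ne_one L) w hw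
  -- names
  set σ : LocalRing L v →+* LocalRing L v := conjLocal L (IsCMField.complexConj L) v with hσdef
  set z : LocalRing L v := ((((n : ↥(unitaryGroupOfForm (conjLocal L (IsCMField.complexConj L) v) (cmLocalForm L 3 v))) : GL (Fin 3) (LocalRing L v)) : Matrix (Fin 3) (Fin 3) (LocalRing L v)) 0 2) with hzdef
  set x : LocalRing L v := ((((n : ↥(unitaryGroupOfForm (conjLocal L (IsCMField.complexConj L) v) (cmLocalForm L 3 v))) : GL (Fin 3) (LocalRing L v)) : Matrix (Fin 3) (Fin 3) (LocalRing L v)) 0 1) with hxdef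
  have hσσ : ∀ r, σ (σ r) = r := conjLocal_conjLocal_cm L v
  have hσv : ∀ r : LocalRing L v, Valued.v (σ r w) = Valued.v (r w) := fun r => valued_conjLocal_apply_of_smul_eq L v w hw r
  -- unitarity: `z + σz = −xσx`
  have hrel : z + σ z = -(x * σ x) :=
    HeisRing.umat_zero_two_add_map σ hσσ (cmLocalForm_eq_over L 3 v) n
  -- `z = a + y`, `a` fixed, `y` skew
  set a : LocalRing L v := -(⅟ (2 : LocalRing L v) * (x * σ x)) with hadef
  set y : LocalRing L v := z - a with hydef
  obtain ⟨hafix, haval⟩ := conj_half_mul_conj_and_valued L v w hw h2w x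
  have hyskew : σ y = -y := by
    have h2 : (⅟ (2 : LocalRing L v)) + ⅟ (2 : LocalRing L v) = 1 := invOf_two_add_invOf_two
    have hσz : σ z = -(x * σ x) - z := by linear_combination hrel
    rw [hydef, map_sub, hafix, hσz, hadef]
    linear_combination (x * σ x) * h2
  have hza : z = a + y := by rw [hydef]; ring
  have hmax : Valued.v (z w) = max (Valued.v (a w)) (Valued.v (y w)) := by
    rw [hza]; exact valued_add_apply_eq_max L v w hw h2w hafix hyskew
  -- `|y|_w < 1` (ramified skew line), `|a|_w = 1`, `|x|_w = 1`
  have hy1 : Valued.v (y w) < 1 := by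
    have hyle : Valued.v (y w) ≤ 1 := (le_max_right _ _).trans (hmax.symm.trans hn).le
    exact valued_skew_apply_lt_one_of_ramified L v w hw he h2w ⟨y, (HeisRing.mem_skewPart_iff _ _).2 hyskew⟩ hyle
  have ha1 : Valued.v (a w) = 1 := by
    refine le_antisymm ((le_max_left _ _).trans (hmax.symm.trans hn).le) ?_
    by_contra h
    have h' : max (Valued.v (a w)) (Valued.v (y w)) < 1 := max_lt (not_le.1 h) hy1
    rw [← hmax, hn] at h'
    exact lt_irrefl _ h'
  have hx1 : Valued.v (x w) = 1 := by
    have hsq : Valued.v (x w) ^ 2 = 1 := by rw [sq, ← haval]; exact ha1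
    exact le_antisymm ((pow_le_one_iff two_ne_zero).1 hsq.le) ((one_le_pow_iff two_ne_zero).1 hsq.ge)
  -- units: `z`, `x`, `a`
  have hz0 : z w ≠ 0 := fun h0 => by rw [h0, map_zero] at hn; exact zero_ne_one hn
  have hx0 : x w ≠ 0 := fun h0 => by rw [h0, map_zero] at hx1; exact zero_ne_one hx1
  have hzU : IsUnit z := by
    have : z ∈ {r : LocalRing L v | IsUnit r} := by rw [setOf_isUnit_eq L v w hw]; exact hz0
    exact this
  have hxU : IsUnit x := by
    have : x ∈ {r : LocalRing L v | IsUnit r} := by rw [setOf_isUnit_eq L v w hw]; exact hx0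
    exact this
  have hz1' : ∀ w' : PlacesOver L v, Valued.v ((hzU.unit : LocalRing L v) w') = 1 := by
    intro w'; obtain rfl : w' = w := Subsingleton.elim _ _; rw [IsUnit.unit_spec]; exact hn
  have hx1' : ∀ w' : PlacesOver L v, Valued.v ((hxU.unit : LocalRing L v) w') = 1 := by
    intro w'; obtain rfl : w' = w := Subsingleton.elim _ _; rw [IsUnit.unit_spec]; exact hx1
  -- the unit `−½` and `â = (−½)·x̂·σx̂`
  set uh : (LocalRing L v)ˣ := -(unitOfInvertible (2 : LocalRing L v))⁻¹ with huhdef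
  have huh : (uh : LocalRing L v) = -⅟ (2 : LocalRing L v) := by
    rw [huhdef, Units.val_neg, val_inv_unitOfInvertible]
  set au : (LocalRing L v)ˣ := uh * (hxU.unit * Units.map (σ : LocalRing L v →* LocalRing L v) hxU.unit) with haudef
  have hau : (au : LocalRing L v) = a := by
    rw [haudef, Units.val_mul, Units.val_mul, Units.coe_map, MonoidHom.coe_coe, IsUnit.unit_spec, huh, hadef]
    ring
  have hχa : χ₁ au = χ₁ uh := by
    rw [haudef, map_mul, hB _ hx1', mul_one]
  -- `ẑ = â · p` with `p` a principal unit
  set p : (LocalRing L v)ˣ := au⁻¹ * hzU.unit with hpdef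
  have ha0 : a w ≠ 0 := fun h0 => by rw [h0, map_zero] at ha1; exact zero_ne_one ha1
  have hp : ∀ w' : PlacesOver L v, Valued.v (((p : LocalRing L v) w') - 1) < 1 := by
    intro w'
    obtain rfl : w' = w := Subsingleton.elim _ _
    have hinv : ((au⁻¹ : (LocalRing L v)ˣ) : LocalRing L v) w' * a w' = 1 := by
      have e := congrArg (fun r : LocalRing L v => r w') au.inv_mul
      rw [hau] at e
      simpa only [Pi.mul_apply, Pi.one_apply] using e
    have hpw : (p : LocalRing L v) w' - 1 = ((au⁻¹ : (LocalRing L v)ˣ) : LocalRing L v) w' * y w' := by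
      rw [hpdef, Units.val_mul, IsUnit.unit_spec, Pi.mul_apply, hza, Pi.add_apply, mul_add, hinv]
      ring
    have hinvv : Valued.v (((au⁻¹ : (LocalRing L v)ˣ) : LocalRing L v) w') = 1 := by
      have e := congrArg (fun t => Valued.v t) hinv
      simp only [map_mul, map_one, ha1, mul_one] at e
      exact e
    rw [hpw, map_mul, hinvv, one_mul]
    exact hy1
  have hχz : χ₁ hzU.unit = χ₁ uh := by
    have e : hzU.unit = au * p := by rw [hpdef, mul_inv_cancel_left]
    rw [e, map_mul, hdepth p hp, mul_one, hχa]
  -- `χ₁(σẑ) = χ₁(ẑ)⁻¹` (Branch B on `ẑ`)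
  have hχσz : χ₁ (Units.map (σ : LocalRing L v →* LocalRing L v) hzU.unit) = (χ₁ hzU.unit)⁻¹ := by
    have e := hB _ hz1'
    rw [map_mul] at e
    exact eq_inv_of_mul_eq_one_right e
  -- `χ₁(−½)⁻¹ = χ₁(−2)`
  have hneg : (χ₁ uh)⁻¹ = χ₁ (-(unitOfInvertible (2 : LocalRing L v))) := by
    rw [← map_inv, huhdef, neg_inv, inv_inv]
  -- `χ₁(−½)² = 1` (Branch B on the fixed unit `−½`), so `χ₁(−½) = χ₁(−2)`
  have huhσ : Units.map (σ : LocalRing L v →* LocalRing L v) uh = uh :=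
    Units.ext (by rw [Units.coe_map, MonoidHom.coe_coe, huh, map_neg, HeisRing.map_invOf_two σ])
  have huh1 : ∀ w' : PlacesOver L v, Valued.v ((uh : LocalRing L v) w') = 1 := by
    intro w'
    obtain rfl : w' = w := Subsingleton.elim _ _
    rw [huh, Pi.neg_apply, Valuation.map_neg, valued_invOf_two_apply L v w' h2w]
  have huhsq : χ₁ uh * χ₁ uh = 1 := by
    have e := hB uh huh1
    rwa [huhσ, map_mul] at e
  have hfinal : χ₁ uh = χ₁ (-(unitOfInvertible (2 : LocalRing L v))) := by
    rw [← hneg]; exact eq_inv_of_mul_eq_one_left huhsq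
  -- `‖ẑ‖ = 1`
  have hmod : unitModulusChar (LocalRing L v) hzU.unit = 1 := unitModulusChar_eq_one_of_forall_v_eq_one L v hzU.unit hz1'
  -- assemble
  rw [dif_pos hzU, hχσz, inv_inv, hχz, hmod, inv_one, hfinal]
  push_cast
  rw [mul_one]

/-! ## §2 The ball `{|z|_w ≤ 1}` and the small ball `{|z|_w < 1}` in the Heisenberg chart; the two volumes -/

/-- The `(0, 2)` entry of the chart element `u(x, y)` is `heisZ σ x y = y − ½xσx` (★ `mat_heisElt`, ★ `heisMatrix`). [cite: Rogawski1990, §1.10 p. 9] -/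
theorem entry_zero_two_heisElt [Invertible (2 : LocalRing L v)] (x : LocalRing L v) (y : ↥(HeisRing.skewPart (conjLocal L (IsCMField.complexConj L) v))) :
    (((((HeisRing.heisElt (conjLocal L (IsCMField.complexConj L) v) (conjLocal_conjLocal_cm L v) (cmLocalForm_eq_over L 3 v) x y :
        ↥(cmBorelTriple L 3 v).N) : ↥(unitaryGroupOfForm (conjLocal L (IsCMField.complexConj L) v) (cmLocalForm L 3 v))) : GL (Fin 3) (LocalRing L v)) :
          Matrix (Fin 3) (Fin 3) (LocalRing L v)) 0 2) = HeisRing.heisZ (conjLocal L (IsCMField.complexConj L) v) x y := by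
  rw [HeisRing.mat_heisElt, HeisRing.coe_heisGL]
  rfl

include hw in
set_option maxHeartbeats 1600000 in
set_option synthInstance.maxHeartbeats 400000 in
-- the GL-coercion chain in the set
/-- **`heisHomeomorph⁻¹ {|z|_w ≤ 1} = 𝒪 × 𝒪⁻`** (`|z|_w = max(|x|_w², |y|_w)` ★ `valued_heisZ_apply_eq_max`; place-generic given `|2|_w = 1`). [cite: Rogawski1990, §1.10 p. 9; §4.9 p. 54] -/
theorem preimage_heisHomeomorph_setOf_v_le_one [Invertible (2 : LocalRing L v)] (h2w : Valued.v (2 : w.1.adicCompletion L) = 1) :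
    (HeisRing.heisHomeomorph (conjLocal L (IsCMField.complexConj L) v) (conjLocal_conjLocal_cm L v) (continuous_conjLocal L (IsCMField.complexConj L) v)
        (cmLocalForm_eq_over L 3 v)) ⁻¹' {m : ↥(cmBorelTriple L 3 v).N | Valued.v (((((m : ↥(unitaryGroupOfForm (conjLocal L (IsCMField.complexConj L) v) (cmLocalForm L 3 v))) : GL (Fin 3) (LocalRing L v)) : Matrix (Fin 3) (Fin 3) (LocalRing L v)) 0 2) w) ≤ 1} =
      {x : LocalRing L v | Valued.v (x w) ≤ 1} ×ˢ {y : ↥(HeisRing.skewPart (conjLocal L (IsCMField.complexConj L) v)) | Valued.v ((y : LocalRing L v) w) ≤ 1} := by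
  ext ⟨x, y⟩
  simp only [Set.mem_preimage, Set.mem_setOf_eq, HeisRing.heisHomeomorph_apply, Set.mem_prod]
  rw [entry_zero_two_heisElt, valued_heisZ_apply_eq_max L v w hw h2w x y, max_le_iff, ← sq, pow_le_one_iff two_ne_zero]

include hw in
set_option maxHeartbeats 1600000 in
set_option synthInstance.maxHeartbeats 400000 in
-- the GL-coercion chain in the set
/-- **`heisHomeomorph⁻¹ {|z|_w < 1} = 𝔪 × 𝔪⁻`** (`|z|_w = max(|x|_w², |y|_w)` ★; place-generic given `|2|_w = 1`). [cite: Rogawski1990, §1.10 p. 9; §4.9 p. 54] -/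
theorem preimage_heisHomeomorph_setOf_v_lt_one [Invertible (2 : LocalRing L v)] (h2w : Valued.v (2 : w.1.adicCompletion L) = 1) :
    (HeisRing.heisHomeomorph (conjLocal L (IsCMField.complexConj L) v) (conjLocal_conjLocal_cm L v) (continuous_conjLocal L (IsCMField.complexConj L) v)
        (cmLocalForm_eq_over L 3 v)) ⁻¹' {m : ↥(cmBorelTriple L 3 v).N | Valued.v (((((m : ↥(unitaryGroupOfForm (conjLocal L (IsCMField.complexConj L) v) (cmLocalForm L 3 v))) : GL (Fin 3) (LocalRing L v)) : Matrix (Fin 3) (Fin 3) (LocalRing L v)) 0 2) w) < 1} =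
      {x : LocalRing L v | Valued.v (x w) < 1} ×ˢ {y : ↥(HeisRing.skewPart (conjLocal L (IsCMField.complexConj L) v)) | Valued.v ((y : LocalRing L v) w) < 1} := by
  ext ⟨x, y⟩
  simp only [Set.mem_preimage, Set.mem_setOf_eq, HeisRing.heisHomeomorph_apply, Set.mem_prod]
  rw [entry_zero_two_heisElt, valued_heisZ_apply_eq_max L v w hw h2w x y, max_lt_iff, ← sq, pow_lt_one_iff two_ne_zero]

include hw in
set_option maxHeartbeats 1600000 in
set_option synthInstance.maxHeartbeats 400000 in
-- the GL-coercion chain in the set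
/-- **The ball `N₀ = {|z|_w ≤ 1}` is COMPACT** in `N(L⁺_v)` (the chart image of `𝒪 × 𝒪⁻`, ★ `isCompact_setOf_valued_apply_le_one`, ★ `isClosed_skewPart`), so it has finite Haar measure —
the frame-free form of ★ `K2E3BranchBHaarFactsN.isCompact_setOf_coe_mem`. [cite: Rogawski1990, §1.10 p. 9; §4.9 p. 54] -/
theorem isCompact_setOf_v_le_one_of_v_two (h2w : Valued.v (2 : w.1.adicCompletion L) = 1) : IsCompact {m : ↥(cmBorelTriple L 3 v).N | Valued.v (((((m : ↥(unitaryGroupOfForm (conjLocal L (IsCMField.complexConj L) v) (cmLocalForm L 3 v))) : GL (Fin 3) (LocalRing L v)) : Matrix (Fin 3) (Fin 3) (LocalRing L v)) 0 2) w) ≤ 1} := by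
  letI : Invertible (2 : LocalRing L v) := (isUnit_two_localRing L v).invertible
  have hAc : IsCompact {x : LocalRing L v | Valued.v (x w) ≤ 1} := isCompact_setOf_valued_apply_le_one L v w hw
  have hBc : IsCompact {y : ↥(HeisRing.skewPart (conjLocal L (IsCMField.complexConj L) v)) | Valued.v ((y : LocalRing L v) w) ≤ 1} :=
    (HeisRing.isClosed_skewPart (conjLocal L (IsCMField.complexConj L) v) (continuous_conjLocal L (IsCMField.complexConj L) v)).isClosedEmbedding_subtypeVal.isCompact_preimage hAc
  rw [← (HeisRing.heisHomeomorph (conjLocal L (IsCMField.complexConj L) v) (conjLocal_conjLocal_cm L v) (continuous_conjLocal L (IsCMField.complexConj L) v)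
        (cmLocalForm_eq_over L 3 v)).image_preimage {m : ↥(cmBorelTriple L 3 v).N | Valued.v (((((m : ↥(unitaryGroupOfForm (conjLocal L (IsCMField.complexConj L) v) (cmLocalForm L 3 v))) : GL (Fin 3) (LocalRing L v)) : Matrix (Fin 3) (Fin 3) (LocalRing L v)) 0 2) w) ≤ 1},
    preimage_heisHomeomorph_setOf_v_le_one L v w hw h2w]
  exact (hAc.prod hBc).image (HeisRing.heisHomeomorph (conjLocal L (IsCMField.complexConj L) v) (conjLocal_conjLocal_cm L v) (continuous_conjLocal L (IsCMField.complexConj L) v)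
        (cmLocalForm_eq_over L 3 v)).continuous

include hw in
set_option maxHeartbeats 1600000 in
set_option synthInstance.maxHeartbeats 400000 in
-- the chart bookkeeping (two preimages + the master evaluation) with the GL-coercion chain in every set
/-- **`μ{n : |(n₀₂)_w| < 1} = q⁻¹ · μ{n : |(n₀₂)_w| ≤ 1}`** (`q = N𝔭_v`) for EVERY Haar measure `μ` on `N(L⁺_v)`, `v` non-split, RAMIFIED in `L` (`he`), `|2|_w = 1`: in the
Heisenberg chart the two sets are `𝔪 × 𝔪⁻` and `𝒪 × 𝒪⁻` (§2), `𝔪⁻ = 𝒪⁻` at a ramified place (★ `setOf_skew_valued_lt_one_eq_of_ramified`), the master evaluation ★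
`exists_measure_eq_mul_of_preimage_heisHomeomorph` and `μ_R(𝔪) = q⁻¹μ_R(𝒪)` (★ `measure_setOf_valued_lt_one_of_ramified`) — `vol N(𝔭) = q⁻¹ · vol N₀` (the frame-free form of ★
`R90S1BranchBHaarFactsNRamified`). [cite: Rogawski1990, §4.9 p. 54; §12.2 p. 173] -/
theorem measure_setOf_v_lt_one_eq_ram (he : v.asIdeal.ramificationIdx' w.1.asIdeal ≠ 1) (h2w : Valued.v (2 : w.1.adicCompletion L) = 1)
    [MeasurableSpace ↥(cmBorelTriple L 3 v).N] [BorelSpace ↥(cmBorelTriple L 3 v).N] (μ : Measure ↥(cmBorelTriple L 3 v).N) [μ.IsHaarMeasure] :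
    μ {m : ↥(cmBorelTriple L 3 v).N | Valued.v (((((m : ↥(unitaryGroupOfForm (conjLocal L (IsCMField.complexConj L) v) (cmLocalForm L 3 v))) : GL (Fin 3) (LocalRing L v)) : Matrix (Fin 3) (Fin 3) (LocalRing L v)) 0 2) w) < 1} = (((Ideal.absNorm v.asIdeal : ℝ≥0))⁻¹ : ℝ≥0) • μ {m : ↥(cmBorelTriple L 3 v).N | Valued.v (((((m : ↥(unitaryGroupOfForm (conjLocal L (IsCMField.complexConj L) v) (cmLocalForm L 3 v))) : GL (Fin 3) (LocalRing L v)) : Matrix (Fin 3) (Fin 3) (LocalRing L v)) 0 2) w) ≤ 1} := by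
  haveI : SecondCountableTopology (LocalRing L v) := secondCountableTopology_localRing (E := L) v
  letI : MeasurableSpace (LocalRing L v) := borel _
  haveI : BorelSpace (LocalRing L v) := ⟨rfl⟩
  letI : Invertible (2 : LocalRing L v) := (isUnit_two_localRing L v).invertible
  haveI := HeisRing.locallyCompactSpace_skewPart (conjLocal L (IsCMField.complexConj L) v) (continuous_conjLocal L (IsCMField.complexConj L) v)
  haveI : SecondCountableTopology ↥(HeisRing.skewPart (conjLocal L (IsCMField.complexConj L) v)) := TopologicalSpace.Subtype.secondCountableTopology _
  obtain ⟨μX, hμX⟩ : ∃ m : Measure (LocalRing L v), m = Measure.addHaar := ⟨_, rfl⟩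
  obtain ⟨μY, hμY⟩ : ∃ m : Measure ↥(HeisRing.skewPart (conjLocal L (IsCMField.complexConj L) v)), m = Measure.addHaar := ⟨_, rfl⟩
  haveI : μX.IsAddHaarMeasure := by rw [hμX]; infer_instance
  haveI : μX.Regular := by rw [hμX]; infer_instance
  haveI : μY.IsAddHaarMeasure := by rw [hμY]; infer_instance
  obtain ⟨κ, hκ⟩ := exists_measure_eq_mul_of_preimage_heisHomeomorph L v μ μX μY
  rw [hκ _ _ _ (preimage_heisHomeomorph_setOf_v_lt_one L v w hw h2w), hκ _ _ _ (preimage_heisHomeomorph_setOf_v_le_one L v w hw h2w),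
    measure_setOf_valued_lt_one_of_ramified L v w hw μX he, setOf_skew_valued_lt_one_eq_of_ramified L v w hw he h2w, ENNReal.smul_def, ENNReal.smul_def,
    smul_eq_mul, smul_eq_mul]
  ring

include hw in
set_option maxHeartbeats 1600000 in
set_option synthInstance.maxHeartbeats 400000 in
-- the GL-coercion chain in the three sets
/-- **`μ.real(Sh 0) = (1 − q⁻¹) · μ.real{|z|_w ≤ 1}`** for EVERY Haar `μ` on `N(L⁺_v)` at a tame RAMIFIED non-split place (`Sh 0 = {|z|_w ≤ 1} ∖ {|z|_w < 1}`, the ratio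
`measure_setOf_v_lt_one_eq_ram`, the ball is compact). [cite: Rogawski1990, §4.9 p. 54; §12.2 p. 173] [cite: Casselman1995, §6.4 p. 63] -/
theorem measureReal_setOf_v_eq_one_eq_ram (he : v.asIdeal.ramificationIdx' w.1.asIdeal ≠ 1) (h2w : Valued.v (2 : w.1.adicCompletion L) = 1)
    [MeasurableSpace ↥(cmBorelTriple L 3 v).N] [BorelSpace ↥(cmBorelTriple L 3 v).N] (μ : Measure ↥(cmBorelTriple L 3 v).N) [μ.IsHaarMeasure] :
    μ.real {m : ↥(cmBorelTriple L 3 v).N | Valued.v (((((m : ↥(unitaryGroupOfForm (conjLocal L (IsCMField.complexConj L) v) (cmLocalForm L 3 v))) : GL (Fin 3) (LocalRing L v)) : Matrix (Fin 3) (Fin 3) (LocalRing L v)) 0 2) w) = 1} = (1 - (Ideal.absNorm v.asIdeal : ℝ)⁻¹) * μ.real {m : ↥(cmBorelTriple L 3 v).N | Valued.v (((((m : ↥(unitaryGroupOfForm (conjLocal L (IsCMField.complexConj L) v) (cmLocalForm L 3 v))) : GL (Fin 3) (LocalRing L v)) : Matrix (Fin 3) (Fin 3) (LocalRing L v)) 0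 2) w) ≤ 1} := by
  have hfin : μ {m : ↥(cmBorelTriple L 3 v).N | Valued.v (((((m : ↥(unitaryGroupOfForm (conjLocal L (IsCMField.complexConj L) v) (cmLocalForm L 3 v))) : GL (Fin 3) (LocalRing L v)) : Matrix (Fin 3) (Fin 3) (LocalRing L v)) 0 2) w) ≤ 1} ≠ ∞ := (isCompact_setOf_v_le_one_of_v_two L v w hw h2w).measure_lt_top.ne
  have hsub : {m : ↥(cmBorelTriple L 3 v).N | Valued.v (((((m : ↥(unitaryGroupOfForm (conjLocal L (IsCMField.complexConj L) v) (cmLocalForm L 3 v))) : GL (Fin 3) (LocalRing L v)) : Matrix (Fin 3) (Fin 3) (LocalRing L v)) 0 2) w) < 1} ⊆ {m : ↥(cmBorelTriple L 3 v).N | Valued.v (((((m : ↥(unitaryGroupOfForm (conjLocal L (IsCMField.complexConj L) v) (cmLocalForm L 3 v))) : GL (Fin 3) (LocalRing L v)) : Matrix (Fin 3) (Fin 3) (LocalRing L v)) 0 2) w) ≤ 1} := by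
    intro m hm
    simp only [Set.mem_setOf_eq] at hm ⊢
    exact hm.le
  have hS : {m : ↥(cmBorelTriple L 3 v).N | Valued.v (((((m : ↥(unitaryGroupOfForm (conjLocal L (IsCMField.complexConj L) v) (cmLocalForm L 3 v))) : GL (Fin 3) (LocalRing L v)) : Matrix (Fin 3) (Fin 3) (LocalRing L v)) 0 2) w) = 1} = {m : ↥(cmBorelTriple L 3 v).N | Valued.v (((((m : ↥(unitaryGroupOfForm (conjLocal L (IsCMField.complexConj L) v) (cmLocalForm L 3 v))) : GL (Fin 3) (LocalRing L v)) : Matrix (Fin 3) (Fin 3) (LocalRing L v)) 0 2) w) ≤ 1} \ {m : ↥(cmBorelTriple L 3 v).N | Valued.v (((((m : ↥(unitaryGroupOfForm (conjLocal L (IsCMField.complexConj L) v) (cmLocalForm L 3 v))) : GL (Fin 3) (LocalRing L v)) : Matrix (Fin 3) (Fin 3) (LocalRing L v)) 0 2) w) < 1} := by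
    ext m
    simp only [Set.mem_setOf_eq, Set.mem_sdiff, not_lt]
    exact ⟨fun h => ⟨h.le, h.ge⟩, fun h => le_antisymm h.1 h.2⟩
  have hlt := measure_setOf_v_lt_one_eq_ram L v w hw he h2w μ
  have hmeas : MeasurableSet {m : ↥(cmBorelTriple L 3 v).N | Valued.v (((((m : ↥(unitaryGroupOfForm (conjLocal L (IsCMField.complexConj L) v) (cmLocalForm L 3 v))) : GL (Fin 3) (LocalRing L v)) : Matrix (Fin 3) (Fin 3) (LocalRing L v)) 0 2) w) < 1} :=
    ((isOpen_setOf_valued_apply_lt_one L v w).preimage (K2E3BranchBShellRegions.continuous_entry_zero_two L v)).measurableSet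
  have hle : μ {m : ↥(cmBorelTriple L 3 v).N | Valued.v (((((m : ↥(unitaryGroupOfForm (conjLocal L (IsCMField.complexConj L) v) (cmLocalForm L 3 v))) : GL (Fin 3) (LocalRing L v)) : Matrix (Fin 3) (Fin 3) (LocalRing L v)) 0 2) w) < 1} ≤ μ {m : ↥(cmBorelTriple L 3 v).N | Valued.v (((((m : ↥(unitaryGroupOfForm (conjLocal L (IsCMField.complexConj L) v) (cmLocalForm L 3 v))) : GL (Fin 3) (LocalRing L v)) : Matrix (Fin 3) (Fin 3) (LocalRing L v)) 0 2) w) ≤ 1} := measure_mono hsub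
  rw [measureReal_def, measureReal_def, hS, measure_sdiff hsub hmeas.nullMeasurableSet (ne_top_of_le_ne_top hfin hle), hlt,
    ENNReal.toReal_sub_of_le (by rw [← hlt]; exact hle) hfin, ENNReal.toReal_smul, NNReal.smul_def, smul_eq_mul]
  push_cast
  ring

/-! ## §3 Letter `h0`: `∫_{Sh 0} F₀ dμ = χ₁(−2) · ((q − 1)∕q) · μ{|z|_w ≤ 1}` -/

include hw in
set_option maxHeartbeats 1600000 in
set_option synthInstance.maxHeartbeats 400000 in
-- statement elaboration of the frame-v1 integrand (as ★ p862406's binders)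
/-- **THE EVEN SHELL (letter `h0` of the ramified d0B sockets).**  `v` non-split, `w ∣ v` RAMIFIED with `|2|_w = 1`; `χ₁` with :155's `hdepth`, `hB`; `μ` ANY Haar measure on
`N(L⁺_v)`.  Then
**`∫_{|z|_w = 1} F₀ dμ = χ₁(−2) · ((q − 1)∕q) · μ.real{|z|_w ≤ 1}`** — §1 (`F₀ ≡ χ₁(−2)` on the shell) and §2 (`μ(Sh 0) = (1 − q⁻¹)·V`).  This is the binder `h0` of
★∕📤 `R90S1BranchBClosedFormsRamified.integral_weyl_one_eq_of_shells_ram` with its free constant `c₀ := χ₁(−2)` (`c₀² = 1`: §1 `chi_neg_two_sq_eq_one_ram`).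
[cite: Keys1984, §7 Theorem (2) (d) p. 126] [cite: Casselman1995, §6.4 p. 63] [cite: Rogawski1990, §12.2 p. 173] -/
theorem integral_Sh_zero_eq_ram [Invertible (2 : LocalRing L v)]
    (he : v.asIdeal.ramificationIdx' w.1.asIdeal ≠ 1) (h2w : Valued.v (2 : w.1.adicCompletion L) = 1)
    (χ₁ : (LocalRing L v)ˣ →* ℂˣ)
    (hdepth : ∀ u : (LocalRing L v)ˣ, (∀ w' : PlacesOver L v, Valued.v (((u : LocalRing L v) w') - 1) < 1) → χ₁ u = 1)
    (hB : ∀ u : (LocalRing L v)ˣ, (∀ w' : PlacesOver L v, Valued.v ((u : LocalRing L v) w') = 1) →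
      χ₁ (u * Units.map (conjLocal L (IsCMField.complexConj L) v : LocalRing L v →* LocalRing L v) u) = 1)
    [MeasurableSpace ↥(cmBorelTriple L 3 v).N] [BorelSpace ↥(cmBorelTriple L 3 v).N] (μ : Measure ↥(cmBorelTriple L 3 v).N) [μ.IsHaarMeasure] :
    ∫ n in {m : ↥(cmBorelTriple L 3 v).N | Valued.v (((((m : ↥(unitaryGroupOfForm (conjLocal L (IsCMField.complexConj L) v) (cmLocalForm L 3 v))) : GL (Fin 3) (LocalRing L v)) : Matrix (Fin 3) (Fin 3) (LocalRing L v)) 0 2) w) = 1}, (fun n : ↥(cmBorelTriple L 3 v).N =>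
        if h : IsUnit ((((n : ↥(unitaryGroupOfForm (conjLocal L (IsCMField.complexConj L) v) (cmLocalForm L 3 v))) : GL (Fin 3) (LocalRing L v)) : Matrix (Fin 3) (Fin 3) (LocalRing L v)) 0 2) then
          ((((χ₁ (Units.map ((conjLocal L (IsCMField.complexConj L) v) : LocalRing L v →* LocalRing L v) h.unit))⁻¹ : ℂˣ) : ℂ) *
            ((((unitModulusChar (LocalRing L v) h.unit)⁻¹ : ℝ≥0) : ℝ) : ℂ))
        else 0) n ∂μ =
      ((χ₁ (-(unitOfInvertible (2 : LocalRing L v))) : ℂˣ) : ℂ) * ((((Ideal.absNorm v.asIdeal : ℝ) : ℂ) - 1) / ((Ideal.absNorm v.asIdeal : ℝ) : ℂ)) * ((μ.real {m : ↥(cmBorelTriple L 3 v).N | Valued.v (((((m : ↥(unitaryGroupOfForm (conjLocal L (IsCMField.complexConj L) v) (cmLocalForm L 3 v))) : GL (Fin 3) (LocalRing L v)) : Matrix (Fin 3) (Fin 3) (LocalRing L v)) 0 2) w) ≤ 1} : ℝ) : ℂ) := by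
  have hS : MeasurableSet {m : ↥(cmBorelTriple L 3 v).N | Valued.v (((((m : ↥(unitaryGroupOfForm (conjLocal L (IsCMField.complexConj L) v) (cmLocalForm L 3 v))) : GL (Fin 3) (LocalRing L v)) : Matrix (Fin 3) (Fin 3) (LocalRing L v)) 0 2) w) = 1} := K2E3BranchBShellRegions.measurableSet_setOf_v_eq_one L v w
  have hpt : ∀ n ∈ {m : ↥(cmBorelTriple L 3 v).N | Valued.v (((((m : ↥(unitaryGroupOfForm (conjLocal L (IsCMField.complexConj L) v) (cmLocalForm L 3 v))) : GL (Fin 3) (LocalRing L v)) : Matrix (Fin 3) (Fin 3) (LocalRing L v)) 0 2) w) = 1}, (fun n : ↥(cmBorelTriple L 3 v).N =>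
        if h : IsUnit ((((n : ↥(unitaryGroupOfForm (conjLocal L (IsCMField.complexConj L) v) (cmLocalForm L 3 v))) : GL (Fin 3) (LocalRing L v)) : Matrix (Fin 3) (Fin 3) (LocalRing L v)) 0 2) then
          ((((χ₁ (Units.map ((conjLocal L (IsCMField.complexConj L) v) : LocalRing L v →* LocalRing L v) h.unit))⁻¹ : ℂˣ) : ℂ) *
            ((((unitModulusChar (LocalRing L v) h.unit)⁻¹ : ℝ≥0) : ℝ) : ℂ))
        else 0) n = ((χ₁ (-(unitOfInvertible (2 : LocalRing L v))) : ℂˣ) : ℂ) :=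
    fun n hn => casselmanIntegrand_eq_chi_neg_two_of_v_eq_one_ram L v w hw he h2w χ₁ hdepth hB n hn
  rw [setIntegral_congr_fun hS hpt, setIntegral_const, measureReal_setOf_v_eq_one_eq_ram L v w hw he h2w μ]
  have hq0 : Ideal.absNorm v.asIdeal ≠ 0 := fun h => v.ne_bot (Ideal.absNorm_eq_zero_iff.1 h)
  have hq : (Ideal.absNorm v.asIdeal : ℂ) ≠ 0 := by exact_mod_cast hq0
  rw [Complex.real_smul]
  push_cast
  field_simp

end Summit.HodgeConjecture.HodgeConjecture.R90.S1

end
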